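import Literature.Probability.RandomPlanarGeometry.PoissonVoronoiSAWLaw
import Literature.Probability.RandomPlanarGeometry.HexSAWLattice
import Mathlib.Data.Set.Card.Arithmetic
import HarnessLib

/-!
# Self-avoiding walks on graphs of bounded degree: `cₙ ≤ Δ (Δ-1)^{n-1}` and growth rate `≤ Δ - 1`

Topic `Literature/Probability/RandomPlanarGeometry`; generic SAW combinatorics serving the
definition request `defn-PoissonVoronoiSAWLaw` / `defn-PoissonVoronoiGraph` (item (iv):
"`sawCount` on `voronoiGraph ω` is a.s. finite and `≤ (#vertices in the disc)·3·2^(n-1)`, so the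
connective constant `μ_PV` … lies in `[1, 2]`"). Everything is PROVED; no definition, no named
fact.

Madras–Slade, *The Self-Avoiding Walk* (1993), §1.2, (1.2.4)–(1.2.5): on a graph in which every
vertex has at most `Δ = d + 1` neighbours, an `n`-step self-avoiding walk has at most `Δ` choices
for its first step and at most `Δ - 1 = d` for each later step (it may not return to the vertex it
just left), so `cₙ ≤ Δ (Δ-1)^{n-1}` ("`μ ≤ 2d - 1`" for `ℤᵈ`); consequently
`limsup cₙ^{1/n} ≤ Δ - 1`, uniformly in the root. For the (a.s. trivalent) Poisson honeycomb
`Δ = 3` and the bound is `μ_PV ≤ 2`.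

## Contents (namespace `Literature.Probability.RandomPlanarGeometry.SAW`)

* `sawLists_zero`, `mem_sawLists_succ_iff` — first-step decomposition of self-avoiding vertex
  lists (`sawLists`, `HexSAWLattice.lean`): `l ∈ sawLists G u (n+1)` iff `l = u :: w :: l'` with
  `u ~ w`, `w :: l' ∈ sawLists G w n` and `u ∉ w :: l'`.
* `encard_sawLists_avoid_le` — `#{n-step SAWs from u avoiding a neighbour v} ≤ dⁿ` when every
  vertex has `≤ d + 1` neighbours; `encard_sawLists_succ_le`, **`sawCount_succ_le`**:
  `c_{n+1}(u) ≤ (d+1) dⁿ`; `sawCount_zero`: `c₀ = 1`.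
* **`sawGrowthRate_le_of_degree_le`** — the growth rate from ANY root set is `≤ d`
  (`((d+1) dⁿ)^{1/(n+1)} → d`).

## References

* N. Madras, G. Slade, *The Self-Avoiding Walk*, Birkhäuser (1993), §1.2, (1.2.4)–(1.2.5).
  [`MadrasSlade1993`]
-/

noncomputable section

open Filter Set Function
open scoped ENNReal NNReal Topology

namespace Literature.Probability.RandomPlanarGeometry.SAW

variable {V : Type*} {G : SimpleGraph V}

/-! ### First-step decomposition of self-avoiding lists -/

/-- The `0`-step SAWs from `u` are the singleton list `[u]`. [folklore] -/
theorem sawLists_zero (G : SimpleGraph V) (u : V) : sawLists G u 0 = {[u]} := by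
  ext l
  simp only [mem_sawLists_iff, zero_add, mem_singleton_iff]
  constructor
  · rintro ⟨-, hh, hl, -⟩
    match l, hl with
    | [a], _ => simpa using hh
  · rintro rfl
    exact ⟨List.isChain_singleton u, rfl, rfl, List.nodup_singleton u⟩

/-- **First-step decomposition**: an `(n+1)`-step self-avoiding list from `u` is `u :: w :: l'`
with `u ~ w`, `w :: l'` an `n`-step self-avoiding list from `w`, and `u ∉ w :: l'`
(Madras–Slade §1.2: "at most `2d` choices for the first step and `2d - 1` for each later step").
[cite: MadrasSlade1993, §1.2 (1.2.4)] -/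
theorem mem_sawLists_succ_iff {u : V} {n : ℕ} {l : List V} :
    l ∈ sawLists G u (n + 1) ↔
      ∃ w l', l = u :: w :: l' ∧ G.Adj u w ∧ w :: l' ∈ sawLists G w n ∧ u ∉ w :: l' := by
  constructor
  · rintro ⟨hc, hh, hl, hn⟩
    match l, hl, hh, hc, hn with
    | a :: b :: l', hl, hh, hc, hn =>
      obtain rfl : a = u := by simpa using hh
      rw [List.isChain_cons_cons] at hc
      rw [List.nodup_cons] at hn
      refine ⟨b, l', rfl, hc.1, ⟨hc.2, rfl, ?_, hn.2⟩, hn.1⟩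
      simpa using hl
  · rintro ⟨w, l', rfl, hadj, ⟨hc, -, hl, hn⟩, hu⟩
    refine ⟨List.isChain_cons_cons.2 ⟨hadj, hc⟩, rfl, by simpa using hl, List.nodup_cons.2 ⟨hu, hn⟩⟩

/-- The tail of an `(n+1)`-step self-avoiding list from `u` avoiding `v` is an `n`-step
self-avoiding list from a neighbour `w ≠ v` of `u` avoiding `u`. [cite: MadrasSlade1993, §1.2 (1.2.4)] -/
theorem tail_mem_of_mem_sawLists_succ {u v : V} {n : ℕ} {l : List V}
    (hl : l ∈ sawLists G u (n + 1)) (hv : v ∉ l) :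
    l.tail ∈ ⋃ w ∈ G.neighborSet u \ {v}, {l' ∈ sawLists G w n | u ∉ l'} := by
  obtain ⟨w, l', rfl, hadj, hmem, hu⟩ := mem_sawLists_succ_iff.1 hl
  refine mem_iUnion₂.2 ⟨w, ⟨hadj, fun h => hv ?_⟩, hmem, hu⟩
  rw [mem_singleton_iff] at h
  simp [h]

/-- `tail` is injective on the self-avoiding lists from a fixed root (they all start with it).
[folklore] -/
theorem injOn_tail_sawLists (u : V) (n : ℕ) : InjOn List.tail (sawLists G u n) := by
  intro l hl l' hl' h
  obtain ⟨-, hh, hlen, -⟩ := hl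
  obtain ⟨-, hh', hlen', -⟩ := hl'
  match l, l', hh, hh', h with
  | a :: t, a' :: t', hh, hh', h =>
    have ha : a = u := by simpa using hh
    have ha' : a' = u := by simpa using hh'
    simp only [List.tail_cons] at h
    rw [ha, ha', h]

/-! ### Counting: `cₙ ≤ Δ (Δ - 1)^{n-1}` -/

section Count

variable {d : ℕ}

/-- **Walks avoiding the previous vertex**: if every vertex has at most `d + 1` neighbours, the
number of `n`-step self-avoiding lists from `u` avoiding a given neighbour `v` of `u` is at most
`dⁿ` ("at most `Δ - 1` choices for each later step"). [cite: MadrasSlade1993, §1.2 (1.2.4)] -/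
theorem encard_sawLists_avoid_le (hdeg : ∀ w, (G.neighborSet w).encard ≤ d + 1) :
    ∀ (n : ℕ) {u v : V}, G.Adj u v → {l ∈ sawLists G u n | v ∉ l}.encard ≤ (d : ℕ∞) ^ n := by
  intro n
  induction n with
  | zero =>
    intro u v _
    rw [pow_zero, sawLists_zero]
    refine (encard_le_encard (sep_subset _ _)).trans ?_
    simp
  | succ n ih =>
    intro u v huv
    have hfin : (G.neighborSet u).Finite :=
      finite_of_encard_le_coe (hdeg u)
    have hfin' : (G.neighborSet u \ {v}).Finite := hfin.subset sdiff_subset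
    -- `tail` injects into the union over neighbours `w ≠ v` of lists from `w` avoiding `u`
    have hsub : List.tail '' {l ∈ sawLists G u (n + 1) | v ∉ l} ⊆
        ⋃ w ∈ hfin'.toFinset, {l' ∈ sawLists G w n | u ∉ l'} := by
      rintro _ ⟨l, ⟨hl, hv⟩, rfl⟩
      have := tail_mem_of_mem_sawLists_succ hl hv
      simpa only [Finite.mem_toFinset] using this
    have hinj : InjOn List.tail {l ∈ sawLists G u (n + 1) | v ∉ l} :=
      (injOn_tail_sawLists u (n + 1)).mono (sep_subset _ _)
    calc {l ∈ sawLists G u (n + 1) | v ∉ l}.encard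
        = (List.tail '' {l ∈ sawLists G u (n + 1) | v ∉ l}).encard := (hinj.encard_image).symm
      _ ≤ (⋃ w ∈ hfin'.toFinset, {l' ∈ sawLists G w n | u ∉ l'}).encard := encard_le_encard hsub
      _ ≤ ∑ w ∈ hfin'.toFinset, {l' ∈ sawLists G w n | u ∉ l'}.encard :=
          Finset.set_encard_biUnion_le _ _
      _ ≤ ∑ _w ∈ hfin'.toFinset, (d : ℕ∞) ^ n := by
          refine Finset.sum_le_sum fun w hw => ?_
          rw [Finite.mem_toFinset] at hw
          exact ih hw.1.symm
      _ = (hfin'.toFinset.card : ℕ∞) * (d : ℕ∞) ^ n := by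
          rw [Finset.sum_const, nsmul_eq_mul]
      _ ≤ (d : ℕ∞) * (d : ℕ∞) ^ n := by
          refine mul_le_mul_left ?_ _
          -- `#(N(u) \ {v}) + 1 = #N(u) ≤ d + 1`
          have hv : v ∈ G.neighborSet u := huv
          have h1 : ((hfin'.toFinset.card : ℕ) : ℕ∞) = (G.neighborSet u \ {v}).encard := by
            rw [← encard_coe_eq_coe_finsetCard, Finite.coe_toFinset]
          have h2 : (G.neighborSet u \ {v}).encard + 1 = (G.neighborSet u).encard := by
            rw [← encard_singleton v, encard_sdiff_add_encard_of_subset (singleton_subset_iff.2 hv)]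
          have h3 : (G.neighborSet u \ {v}).encard + 1 ≤ (d : ℕ∞) + 1 := h2 ▸ hdeg u
          have h4 : (G.neighborSet u \ {v}).encard < (d : ℕ∞) + 1 :=
            (ENat.add_one_le_iff hfin'.encard_lt_top.ne).1 h3
          rw [h1]
          exact (ENat.lt_add_one_iff (ENat.coe_ne_top d)).1 h4
      _ = (d : ℕ∞) ^ (n + 1) := by rw [pow_succ, mul_comm]

/-- **`c_{n+1}(u) ≤ Δ (Δ-1)ⁿ`** with `Δ = d + 1` the degree bound: the first step has `≤ d + 1`
choices, and what follows is a self-avoiding list from the new vertex avoiding `u`.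
[cite: MadrasSlade1993, §1.2 (1.2.4)–(1.2.5)] -/
theorem encard_sawLists_succ_le (hdeg : ∀ w, (G.neighborSet w).encard ≤ d + 1) (u : V) (n : ℕ) :
    (sawLists G u (n + 1)).encard ≤ ((d : ℕ∞) + 1) * (d : ℕ∞) ^ n := by
  have hfin : (G.neighborSet u).Finite := finite_of_encard_le_coe (hdeg u)
  have hsub : List.tail '' sawLists G u (n + 1) ⊆
      ⋃ w ∈ hfin.toFinset, {l' ∈ sawLists G w n | u ∉ l'} := by
    rintro _ ⟨l, hl, rfl⟩
    obtain ⟨w, l', rfl, hadj, hmem, hu⟩ := mem_sawLists_succ_iff.1 hl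
    simp only [Finite.mem_toFinset, mem_iUnion, SimpleGraph.mem_neighborSet, exists_prop]
    exact ⟨w, hadj, hmem, hu⟩
  calc (sawLists G u (n + 1)).encard
      = (List.tail '' sawLists G u (n + 1)).encard := ((injOn_tail_sawLists u (n + 1)).encard_image).symm
    _ ≤ (⋃ w ∈ hfin.toFinset, {l' ∈ sawLists G w n | u ∉ l'}).encard := encard_le_encard hsub
    _ ≤ ∑ w ∈ hfin.toFinset, {l' ∈ sawLists G w n | u ∉ l'}.encard :=
        Finset.set_encard_biUnion_le _ _
    _ ≤ ∑ _w ∈ hfin.toFinset, (d : ℕ∞) ^ n := by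
        refine Finset.sum_le_sum fun w hw => ?_
        rw [Finite.mem_toFinset] at hw
        exact encard_sawLists_avoid_le hdeg n (G.adj_symm hw)
    _ = (hfin.toFinset.card : ℕ∞) * (d : ℕ∞) ^ n := by rw [Finset.sum_const, nsmul_eq_mul]
    _ ≤ ((d : ℕ∞) + 1) * (d : ℕ∞) ^ n := by
        refine mul_le_mul_left ?_ _
        have h1 : ((hfin.toFinset.card : ℕ) : ℕ∞) = (G.neighborSet u).encard := by
          rw [← encard_coe_eq_coe_finsetCard, Finite.coe_toFinset]
        rw [h1]
        exact hdeg u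

/-- `c₀(u) = 1` (the empty walk). [folklore] -/
theorem sawCount_zero (G : SimpleGraph V) (u : V) : sawCount G u 0 = 1 := by
  rw [sawCount_eq_ncard_sawLists, sawLists_zero, ncard_singleton]

/-- **`c_{n+1}(u) ≤ (d+1) dⁿ`** for a graph all of whose vertices have at most `d + 1`
neighbours (Madras–Slade (1.2.5): `cₙ ≤ 2d(2d-1)^{n-1}` on `ℤᵈ`; honeycomb: `cₙ ≤ 3·2^{n-1}`).
[cite: MadrasSlade1993, §1.2 (1.2.5)] -/
theorem sawCount_succ_le (hdeg : ∀ w, (G.neighborSet w).encard ≤ d + 1) (u : V) (n : ℕ) :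
    sawCount G u (n + 1) ≤ (d + 1) * d ^ n := by
  have h := encard_sawLists_succ_le hdeg u n
  have hcast : ((d : ℕ∞) + 1) * (d : ℕ∞) ^ n = (((d + 1) * d ^ n : ℕ) : ℕ∞) := by push_cast; ring
  have hfin : (sawLists G u (n + 1)).Finite := finite_of_encard_le_coe (h.trans_eq hcast)
  have h' : ((sawLists G u (n + 1)).ncard : ℕ∞) ≤ (((d + 1) * d ^ n : ℕ) : ℕ∞) := by
    rw [hfin.cast_ncard_eq]; exact h.trans_eq hcast
  rw [sawCount_eq_ncard_sawLists]
  exact_mod_cast h'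

/-- The self-avoiding lists of a bounded-degree graph are finite sets. [folklore] -/
theorem finite_sawLists (hdeg : ∀ w, (G.neighborSet w).encard ≤ d + 1) (u : V) (n : ℕ) :
    (sawLists G u n).Finite := by
  cases n with
  | zero => rw [sawLists_zero]; exact finite_singleton _
  | succ n =>
    have hcast : ((d : ℕ∞) + 1) * (d : ℕ∞) ^ n = (((d + 1) * d ^ n : ℕ) : ℕ∞) := by push_cast; ring
    exact finite_of_encard_le_coe ((encard_sawLists_succ_le hdeg u n).trans_eq hcast)

end Count

/-! ### Growth rate `≤ Δ - 1` -/

section Growth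

variable {d : ℕ}

/-- `((d + 1) · dⁿ)^{1/(n+1)} → d` in `ℝ≥0∞` (`C^{1/n} → 1`). [folklore] -/
theorem tendsto_degreeBound_rpow (d : ℕ) :
    Tendsto (fun n : ℕ => (((d : ℝ≥0∞) + 1) * (d : ℝ≥0∞) ^ n) ^ (1 / ((n : ℝ) + 1))) atTop
      (𝓝 (d : ℝ≥0∞)) := by
  rcases Nat.eq_zero_or_pos d with rfl | hd
  · -- `d = 0`: the sequence is eventually `0`
    rw [Nat.cast_zero]
    apply (tendsto_const_nhds (x := (0 : ℝ≥0∞))).congr'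
    filter_upwards [eventually_ge_atTop 1] with n hn
    obtain ⟨m, rfl⟩ := Nat.exists_eq_add_of_le' hn
    rw [zero_add, pow_succ, mul_zero, mul_zero, ENNReal.zero_rpow_of_pos (by positivity)]
  · -- `d ≥ 1`: `((d+1) dⁿ)^{1/(n+1)} = (d+1)^{1/(n+1)} · d^{n/(n+1)}` and both factors converge
    have hd0 : (d : ℝ) ≠ 0 := by exact_mod_cast hd.ne'
    have key : ∀ n : ℕ, (((d : ℝ≥0∞) + 1) * (d : ℝ≥0∞) ^ n) ^ (1 / ((n : ℝ) + 1)) =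
        ENNReal.ofReal ((((d : ℝ) + 1) / d) ^ (1 / ((n : ℝ) + 1)) * d) := by
      intro n
      have hn : (0 : ℝ) < (n : ℝ) + 1 := by positivity
      have h1 : ((d : ℝ≥0∞) + 1) * (d : ℝ≥0∞) ^ n = ENNReal.ofReal (((d : ℝ) + 1) * (d : ℝ) ^ n) := by
        rw [ENNReal.ofReal_mul (by positivity), ENNReal.ofReal_pow (by positivity),
          ENNReal.ofReal_add (by positivity) zero_le_one, ENNReal.ofReal_natCast, ENNReal.ofReal_one]
      rw [h1, ENNReal.ofReal_rpow_of_nonneg (by positivity) (by positivity)]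
      congr 1
      rw [Real.mul_rpow (by positivity) (by positivity), Real.div_rpow (by positivity) (by positivity)]
      have h2 : ((d : ℝ) ^ n) ^ (1 / ((n : ℝ) + 1)) = (d : ℝ) / (d : ℝ) ^ (1 / ((n : ℝ) + 1)) := by
        rw [eq_div_iff (by positivity), ← Real.rpow_natCast, ← Real.rpow_mul (by positivity),
          ← Real.rpow_add (by positivity)]
        have : (n : ℝ) * (1 / ((n : ℝ) + 1)) + 1 / ((n : ℝ) + 1) = 1 := by
          field_simp
        rw [this, Real.rpow_one]
      rw [h2]
      field_simp
    rw [show (fun n : ℕ => (((d : ℝ≥0∞) + 1) * (d : ℝ≥0∞) ^ n) ^ (1 / ((n : ℝ) + 1))) =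
        fun n : ℕ => ENNReal.ofReal ((((d : ℝ) + 1) / d) ^ (1 / ((n : ℝ) + 1)) * d) from funext key]
    have hlim : Tendsto (fun n : ℕ => (((d : ℝ) + 1) / d) ^ (1 / ((n : ℝ) + 1)) * d) atTop
        (𝓝 (1 * d)) := by
      refine Tendsto.mul_const _ ?_
      have hC : (0 : ℝ) < ((d : ℝ) + 1) / d := by positivity
      have h1 : Tendsto (fun n : ℕ => Real.log (((d : ℝ) + 1) / d) / ((n : ℝ) + 1)) atTop (𝓝 0) := by
        have := tendsto_const_div_atTop_nhds_zero_nat (Real.log (((d : ℝ) + 1) / d))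
        exact (this.comp (tendsto_add_atTop_nat 1)).congr fun n => by simp
      have h2 := (Real.continuous_exp.tendsto 0).comp h1
      rw [Real.exp_zero] at h2
      refine h2.congr fun n => ?_
      simp only [Function.comp_apply]
      rw [Real.rpow_def_of_pos hC, div_eq_mul_one_div]
    rw [one_mul] at hlim
    have := ENNReal.tendsto_ofReal hlim
    rwa [ENNReal.ofReal_natCast] at this

/-- **Bounded degree bounds the growth rate**: if every vertex of `G` has at most `d + 1`
neighbours then the SAW growth rate from ANY root set is `≤ d` (`cₙ(c) ≤ (d+1) d^{n-1}` uniformly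
in the root `c`, and `((d+1) d^{n-1})^{1/n} → d`). For the trivalent honeycomb, `≤ 2`.
[cite: MadrasSlade1993, §1.2 (1.2.5)] -/
theorem sawGrowthRate_le_of_degree_le (hdeg : ∀ w, (G.neighborSet w).encard ≤ d + 1)
    (K : Set V) : sawGrowthRate G K ≤ d := by
  -- compare with the shifted sequence `b (n+1) = ((d+1) dⁿ)^{1/(n+1)}`
  have hb : Tendsto (fun n : ℕ => (((d : ℝ≥0∞) + 1) * (d : ℝ≥0∞) ^ (n - 1)) ^ (1 / (n : ℝ)))
      atTop (𝓝 (d : ℝ≥0∞)) := by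
    rw [← tendsto_add_atTop_iff_nat 1]
    refine (tendsto_degreeBound_rpow d).congr fun n => ?_
    simp
  refine (limsup_le_limsup (Eventually.of_forall fun n => ?_)).trans hb.limsup_eq.le
  rcases Nat.eq_zero_or_pos n with rfl | hn
  · simp
  · refine ENNReal.rpow_le_rpow (iSup_le fun c => ?_) (by positivity)
    obtain ⟨m, rfl⟩ := Nat.exists_eq_add_of_le' hn
    have := sawCount_succ_le hdeg (c : V) m
    calc (sawCount G (c : V) (m + 1) : ℝ≥0∞) ≤ (((d + 1) * d ^ m : ℕ) : ℝ≥0∞) := by exact_mod_cast this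
      _ = ((d : ℝ≥0∞) + 1) * (d : ℝ≥0∞) ^ (m + 1 - 1) := by push_cast; simp

end Growth

end Literature.Probability.RandomPlanarGeometry.SAW
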